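import Literature.AnabelianGeometry.EtaleTheta.ArithThetaTowerThetaRestBirat
import Literature.AnabelianGeometry.EtaleTheta.ArithThetaTowerFrobenioidLaws
import Literature.AnabelianGeometry.EtaleTheta.ArithThetaTowerIsFrobenioid
import Literature.IUT.HodgeTheaters.InitialThetaDataBadLocalFrobenioidOfDoubleUnderline
import HarnessLib

/-!
# [IUTchI] Ex. 3.2 (i)(ii)(v) AT ONE GENUINE BAD PLACE: the C0 WITNESS OF RECORD — the REAL-birationalization rest input
# `TemperedThetaRestBirat` is INHABITED at `(K_w, Gal(K̄_w/K_w), Π^tp_{X̲̲_v̲} ⊇ Π^tp_{Ÿ̲̲}, q̲_v̲)` by the arithmetic theta tower's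
# tempered Frobenioid with the Θ̲-reading `𝒞^Θ_v ⊆ ℱ÷_v` (GAP A item GA-15 = C0; COUNT-NEUTRAL milestone, RULINGS #333 (b)/#344 (B)(ii))

S. Mochizuki, *Inter-universal Teichmüller Theory I* [Mochizuki2012], Ex. 3.2 (i)(ii) p. 70, (v) p. 72
[claim: Mochizuki2012, status: disputed] (D-0012 claim key; a CONSTRUCTION over OUR typed objects; nothing of the series
asserted).  GAP A of record G-L5-EX32I-1 (abc-iut cell), keeper-A C0 ONE-LINE SPEC (cell STATUS l.121365) VERBATIM, with
the one-token edit `hF₀ := isFrobenioid_realifiedOf _ T₀ _ _ _` (GA-05 ★, hypothesis-free at the term).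

THE ONE DATUM: `d₀ := GaloisValDatum.ofPlace K p w hw` (genuine `K_w`, genuine `Gal(K̄_w/K_w)`), the THETA-TYPE group datum
`T₀ := InitialThetaData.badGroupDatumOfDoubleUnderline w p hw dGL hS2 C ι` (`P₀ = ↥C.Huu = Π^tp_{X̲̲_v̲}`, `T₀.Y = Π^tp_{Ÿ̲̲}` —
print's `Π_v̲ ⊇ Π_Ÿ` ON THE NOSE, the #322 GUARD), the genuine `q̲`-root `D.qRootAt_not_isUnit hv w p hw`, `l` from the initial
Θ-data.  THE INHABITANT: GA-16's `thetaRestBirat_of_carrierSpec` (GA-06's `theta`/`lZ l`/`constUnits`/`cThetaToBirat` —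
the Θ̲-READING «`q̲_v|_{T_A} ↦ Θ̲_v|_{T_{A^Θ}}`», faithful and over `𝒟^Θ_v → 𝒟_v` by GA-16 — and GA-13's `cdashToC` triple)
at GA-12's term `temperedFrobenioid d₀ T₀` through `carrierSpec_temperedFrobenioid d₀ T₀`; `[IsTopologicalGroup ↥C.Huu]` by
inference.  The constants-composite inhabitant (`thetaRestBiratOfConsts`, ArithThetaTowerOneDatum.lean) is the NV MILESTONE only
(#344 (B)(i)); THIS file is what GA-07's «START AFTER C0» keys on (#344 (B)(ii)).

HONEST FRAMING: a COUNT-NEUTRAL non-vacuity witness at OUR typed objects (no token moves on C0; the A-token is GA-07's generic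
`def` + GA-08/GA-14 under H+); typed ≠ inhabited-in-print ≠ proved-in-print; the [EtTh] §1/§2 objects `ThetaSetting` /
`EtaleThetaData` / `DoubleUnderline` are typed INTERFACE DATA; an UNDISPUTED construction around [IUTchIII] Cor. 3.12, which
stays OPEN by charter (D-0045) — no side taken on it or on any author; nothing here asserts the abc conjecture proved or
refuted; MORATORIUM rq128 untouched.  No instance, no notation, no `sorry`.
-/

noncomputable section

namespace Literature.AnabelianGeometry.EtaleTheta.ArithThetaTower

open CategoryTheory NumberField IsDedekindDomain Literature.AnabelianGeometry.SemiGraphs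
  Literature.IUT.HodgeTheaters Literature.AlgebraicGeometry.Frobenioids
  Literature.AlgebraicGeometry.Frobenioids.PadicFrd _root_.Topology

variable {F K Fbar : Type} [Field F] [NumberField F] [Field K] [NumberField K] [Algebra F K]
  [Field Fbar] [Algebra F Fbar] [Algebra K Fbar] [IsScalarTower F K Fbar] {E : WeierstrassCurve F}
  [E.IsElliptic] {l : ℕ} {Pb : BadPlacePredicates K} (D : InitialThetaData F K Fbar E l Pb)
  {v : FinitePlace F} (hv : v ∈ D.VFbad) (w : HeightOneSpectrum (𝓞 K)) [w.asIdeal.LiesOver v.maximalIdeal.asIdeal]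
  (p : ℕ) [Fact p.Prime] (hw : ((p : ℕ) : 𝓞 K) ∈ w.asIdeal)
  {S : ThetaSetting p} {ES : S.EtaleThetaData} (dGL : S.toTemperedCurve.GroupLevelData) (hS2 : S.Sec2Hyps)
  (C : ES.DoubleUnderline l) (ι : ↥S.GK ≃ₜ* (GaloisValDatum.ofPlace K p w hw).Gal)

/-- **THE C0 WITNESS OF RECORD** ([IUTchI] Ex. 3.2 (ii)/(v) at ONE genuine bad place): the REAL-birationalization rest input over
the arithmetic theta tower's tempered Frobenioid `temperedFrobenioid d₀ T₀` at `d₀ = (K_w, Gal(K̄_w/K_w))`, `T₀ = (Π^tp_{X̲̲_v̲} ⊇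
Π^tp_{Ÿ̲̲})`, `q̲ = D.qRootAt`, with `Θ̲_v`, `l·ℤ`, the genuine constants, `𝒞⊢_v → 𝒞_v` (GA-13) and the Θ̲-reading `𝒞^Θ_v ⊆ ℱ÷_v`
(GA-06 `cThetaToBirat`, faithful/base GA-16) — GA-16's `thetaRestBirat_of_carrierSpec` BY NAME at GA-12's
`carrierSpec_temperedFrobenioid d₀ T₀`, `hF₀ := isFrobenioid_realifiedOf _ T₀ _ _ _` (GA-05).  COUNT-NEUTRAL.
([IUTchI] Ex 3.2 (ii) p.70) [claim: Mochizuki2012, status: disputed] -/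
def thetaRestBirat_ofDoubleUnderline' :
    TemperedThetaRestBirat (GaloisValDatum.ofPlace K p w hw) (InitialThetaData.badGroupDatumOfDoubleUnderline w p hw dGL hS2 C ι)
      (D.qRootAt_not_isUnit hv w p hw)
      (temperedFrobenioid (GaloisValDatum.ofPlace K p w hw) (InitialThetaData.badGroupDatumOfDoubleUnderline w p hw dGL hS2 C ι))
      (isFrobenioid_realifiedOf _ (InitialThetaData.badGroupDatumOfDoubleUnderline w p hw dGL hS2 C ι) _ _ _) :=
  thetaRestBirat_of_carrierSpec (carrierSpec_temperedFrobenioid _ _) _ (D.qRootAt_not_isUnit hv w p hw) l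

/-- **C0 NON-VACUITY OF RECORD**: the slot type `TemperedThetaRestBirat d₀ T₀ hq₀ (temperedFrobenioid d₀ T₀) hF₀` is INHABITED at
the one genuine datum (keeper-A C0 spec, RULINGS #333 (b)/#344 (B)(ii)).  COUNT-NEUTRAL. ([IUTchI] Ex 3.2 (ii) p.70)
[claim: Mochizuki2012, status: disputed] -/
theorem nonempty_thetaRestBirat_ofDoubleUnderline' :
    Nonempty (TemperedThetaRestBirat (GaloisValDatum.ofPlace K p w hw)
      (InitialThetaData.badGroupDatumOfDoubleUnderline w p hw dGL hS2 C ι) (D.qRootAt_not_isUnit hv w p hw)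
      (temperedFrobenioid (GaloisValDatum.ofPlace K p w hw) (InitialThetaData.badGroupDatumOfDoubleUnderline w p hw dGL hS2 C ι))
      (isFrobenioid_realifiedOf _ (InitialThetaData.badGroupDatumOfDoubleUnderline w p hw dGL hS2 C ι) _ _ _)) :=
  ⟨thetaRestBirat_ofDoubleUnderline' D hv w p hw dGL hS2 C ι⟩

/-- **The keeper-A C0 ONE-LINE SPEC, name and type VERBATIM** (cell STATUS l.121365 with the one-token edit l.121506): same
inhabitant as `nonempty_thetaRestBirat_ofDoubleUnderline'` (the Θ̲-reading of record).  COUNT-NEUTRAL. ([IUTchI] Ex 3.2 (ii) p.70)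
[claim: Mochizuki2012, status: disputed] -/
theorem nonempty_thetaRestBirat_ofDoubleUnderline :
    Nonempty (TemperedThetaRestBirat (GaloisValDatum.ofPlace K p w hw)
      (InitialThetaData.badGroupDatumOfDoubleUnderline w p hw dGL hS2 C ι) (D.qRootAt_not_isUnit hv w p hw)
      (ArithThetaTower.temperedFrobenioid (GaloisValDatum.ofPlace K p w hw)
        (InitialThetaData.badGroupDatumOfDoubleUnderline w p hw dGL hS2 C ι))
      (isFrobenioid_realifiedOf _ (InitialThetaData.badGroupDatumOfDoubleUnderline w p hw dGL hS2 C ι) _ _ _)) :=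
  nonempty_thetaRestBirat_ofDoubleUnderline' D hv w p hw dGL hS2 C ι

end Literature.AnabelianGeometry.EtaleTheta.ArithThetaTower

end
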